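import Mathlib.Data.Matrix.Mul
import Mathlib.Data.ZMod.Basic
import Mathlib.Tactic.Choose
import HarnessLib

/-!
# Direction separation for `𝔽₂`-valued ridge sums over `(ℤ/3)^r`

**Source of the method.** V. E. Ismailov, *Notes on ridge functions and neural networks* (arXiv:2005.14125,
2020), Ch. 2, Lemma 2.5 and eq. (2.23) [Ismailov2020]: if `f(x) = Σ_{i ≤ k} f_i(aⁱ · x)` with pairwise linearly
independent directions `aⁱ`, then for every `j ≠ k` there is a vector `bʲ` with `bʲ · aʲ = 0`, `bʲ · aᵏ ≠ 0`, the
difference operator `Δ_{bʲ}` kills the `j`-th ridge term, and `Δ_{b¹} ⋯ Δ_{b^{k-1}} f = (Δ ⋯ Δ f_k)(aᵏ · x)`; this is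
the mechanism behind the classical uniqueness of ridge representations up to polynomials of degree `≤ k - 2`
(Pinkus; [Ismailov2020, Ch. 2, discussion of (2.1)–(2.2)]).

**What is supplied here** (the finite instance, fully proved): directions in `(ℤ/3)^r`, values in `𝔽₂`.  Over
`ℤ/3 → 𝔽₂` a function annihilated by an iterated difference with non-zero steps is CONSTANT (a constant `κ` with
`3κ = κ = Σ_t Δ_b g(t) = 0` at each stage), so "polynomial of degree `≤ m - 2`" collapses to "constant":

`dirSep`: if `d₁ … d_m : Fin r → ZMod 3` are non-zero and pairwise non-proportional, `g₁ … g_m : ZMod 3 → ZMod 2`,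
and `p ↦ Σⱼ gⱼ (dⱼ ⬝ᵥ p)` is constant on `Fin r → ZMod 3`, then every `gⱼ` is constant.

(This is the «direction separation» statement used, over the full phase space, in the `AdviceFreeQNC0` cell of
the `QuantumAdvantage` summit; on the Boolean cube `{0,1}^r ⊂ (ℤ/3)^r` it is false for few-coin families — see
`ModThreeTestRelations` for the exact relation module there.)

WHAT THIS IS NOT: nothing over `ℝ` (where the conclusion is only "polynomial of degree `≤ m-2`"), nothing on the
Boolean cube, no named facts, no `sorry`.
-/

namespace Literature.Computability.MetaComplexity

namespace ModThreeDirSep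

open Finset Matrix

/-! ### 1. Differences of functions `ℤ/3 → 𝔽₂` -/

/-- Forward difference with step `a`: `(D a h)(t) = h(t + a) + h(t)`. [folklore] -/
def D (a : ZMod 3) (h : ZMod 3 → ZMod 2) : ZMod 3 → ZMod 2 := fun t => h (t + a) + h t

/-- Iterated forward differences along a list of steps. [folklore] -/
def iterD : List (ZMod 3) → (ZMod 3 → ZMod 2) → ZMod 3 → ZMod 2
  | [], h => h
  | a :: as, h => D a (iterD as h)

/-- `x + x = 0` in `𝔽₂`. [folklore] -/
private theorem add_self_zmod2 (x : ZMod 2) : x + x = 0 := by revert x; decide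

/-- `x + y = 0 → x = y` in `𝔽₂`. [folklore] -/
private theorem eq_of_add_eq_zero {x y : ZMod 2} (h : x + y = 0) : x = y := by
  revert x y; decide

/-- Every element of `ℤ/3` is `0`, `1` or `2`. [folklore] -/
private theorem all_zmod3 (t : ZMod 3) : t = 0 ∨ t = 1 ∨ t = 2 := by revert t; decide

/-- `3 • κ = κ` in `𝔽₂`. [folklore] -/
private theorem three_nsmul (κ : ZMod 2) : 3 • κ = κ := by revert κ; decide

/-- The difference with step `0` vanishes. [folklore] -/
private theorem D_zero (h : ZMod 3 → ZMod 2) : D 0 h = 0 := by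
  funext t; simp only [D, add_zero, Pi.zero_apply, add_self_zmod2]

/-- The difference of the zero function vanishes. [folklore] -/
private theorem D_zero_fun (a : ZMod 3) : D a (0 : ZMod 3 → ZMod 2) = 0 := by
  funext t; simp [D]

/-- A difference has total sum `0`. [folklore] -/
private theorem sum_D (a : ZMod 3) (h : ZMod 3 → ZMod 2) : ∑ t, D a h t = 0 := by
  simp only [D, sum_add_distrib]
  rw [show (∑ t : ZMod 3, h (t + a)) = ∑ t, h t from Equiv.sum_comp (Equiv.addRight a) h, add_self_zmod2]

/-- A function on `ℤ/3` annihilated by a difference with non-zero step is constant. [folklore] -/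
private theorem const_of_D (a : ZMod 3) (ha : a ≠ 0) (h : ZMod 3 → ZMod 2) (h0 : D a h = 0) :
    ∀ t, h t = h 0 := by
  have step : ∀ t, h (t + a) = h t := fun t => eq_of_add_eq_zero (congrFun h0 t)
  have e01 : (0 : ZMod 3) + 1 = 1 := by decide
  have e11 : (1 : ZMod 3) + 1 = 2 := by decide
  have e02 : (0 : ZMod 3) + 2 = 2 := by decide
  have e22 : (2 : ZMod 3) + 2 = 1 := by decide
  intro t
  rcases all_zmod3 a with rfl | rfl | rfl
  · exact absurd rfl ha
  · have h1 : h 1 = h 0 := by have := step 0; rwa [e01] at this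
    have h2 : h 2 = h 1 := by have := step 1; rwa [e11] at this
    rcases all_zmod3 t with rfl | rfl | rfl
    · rfl
    · exact h1
    · rw [h2, h1]
  · have h2 : h 2 = h 0 := by have := step 0; rwa [e02] at this
    have h1 : h 1 = h 2 := by have := step 2; rwa [e22] at this
    rcases all_zmod3 t with rfl | rfl | rfl
    · rfl
    · rw [h1, h2]
    · exact h2

/-- Iterated differences of the zero function vanish. [folklore] -/
private theorem iterD_zero_fun : ∀ as : List (ZMod 3), iterD as (0 : ZMod 3 → ZMod 2) = 0
  | [] => rfl
  | a :: as => by rw [iterD, iterD_zero_fun as, D_zero_fun]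

/-- An iterated difference containing a zero step vanishes. [folklore] -/
private theorem iterD_eq_zero_of_mem : ∀ (as : List (ZMod 3)) (h : ZMod 3 → ZMod 2),
    (0 : ZMod 3) ∈ as → iterD as h = 0
  | [], _, hm => absurd hm (by simp)
  | a :: as, h, hm => by
    rw [iterD]
    rcases List.mem_cons.1 hm with h0 | h0
    · rw [← h0, D_zero]
    · rw [iterD_eq_zero_of_mem as h h0, D_zero_fun]

/-- A function on `ℤ/3` annihilated by an iterated difference with non-zero steps is constant
(the step where `𝔽₂`-values matter: a constant `κ` with `Σ_t κ = 3κ = κ` equal to a total difference sum `0`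
vanishes). [folklore] -/
private theorem const_of_iterD : ∀ (as : List (ZMod 3)) (h : ZMod 3 → ZMod 2),
    as ≠ [] → (∀ a ∈ as, a ≠ 0) → iterD as h = 0 → ∀ t, h t = h 0
  | [], _, hne, _, _ => absurd rfl hne
  | [a], h, _, hall, h0 => const_of_D a (hall a (by simp)) h h0
  | a :: b :: rest, h, _, hall, h0 => by
    have hG : ∀ t, iterD (b :: rest) h t = iterD (b :: rest) h 0 :=
      const_of_D a (hall a (by simp)) _ h0
    have hκ : iterD (b :: rest) h 0 = 0 := by
      have hs : ∑ t, iterD (b :: rest) h t = 0 := sum_D b (iterD rest h)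
      rw [sum_congr rfl fun t _ => hG t, sum_const, card_univ, ZMod.card, three_nsmul] at hs
      exact hs
    have hG0 : iterD (b :: rest) h = 0 := funext fun t => by rw [hG t, hκ]; rfl
    exact const_of_iterD (b :: rest) h (by simp) (fun x hx => hall x (List.mem_cons_of_mem a hx)) hG0

/-! ### 2. Differences of functions on `(ℤ/3)^r` and ridge terms -/

variable {r : ℕ}

/-- Forward difference in the direction `w`. [folklore] -/
def DV (w : Fin r → ZMod 3) (F : (Fin r → ZMod 3) → ZMod 2) : (Fin r → ZMod 3) → ZMod 2 :=
  fun p => F (p + w) + F p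

/-- Iterated forward differences along a list of directions. [folklore] -/
def iterDV : List (Fin r → ZMod 3) → ((Fin r → ZMod 3) → ZMod 2) → (Fin r → ZMod 3) → ZMod 2
  | [], F => F
  | w :: ws, F => DV w (iterDV ws F)

/-- The difference of a ridge term `p ↦ h (d ⬝ᵥ p)` is the ridge term of the univariate difference with step
`d ⬝ᵥ w` [cf. Ismailov2020, Ch. 2, proof of Lemma 2.5]. [folklore] -/
private theorem DV_ridge (w d : Fin r → ZMod 3) (h : ZMod 3 → ZMod 2) :
    DV w (fun p => h (d ⬝ᵥ p)) = fun p => D (d ⬝ᵥ w) h (d ⬝ᵥ p) := by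
  funext p; simp only [DV, D, dotProduct_add]

/-- Iterated version of `DV_ridge`. [folklore] -/
private theorem iterDV_ridge (d : Fin r → ZMod 3) (h : ZMod 3 → ZMod 2) :
    ∀ ws : List (Fin r → ZMod 3),
      iterDV ws (fun p => h (d ⬝ᵥ p)) = fun p => iterD (ws.map fun w => d ⬝ᵥ w) h (d ⬝ᵥ p)
  | [] => rfl
  | w :: ws => by
    rw [iterDV, iterDV_ridge d h ws, DV_ridge]; rfl

/-- `DV` is additive over finite sums. [folklore] -/
private theorem DV_sum {ι : Type*} (w : Fin r → ZMod 3) (s : Finset ι)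
    (F : ι → (Fin r → ZMod 3) → ZMod 2) : DV w (∑ i ∈ s, F i) = ∑ i ∈ s, DV w (F i) := by
  funext p; simp only [DV, Finset.sum_apply, sum_add_distrib]

/-- `iterDV` is additive over finite sums. [folklore] -/
private theorem iterDV_sum {ι : Type*} (s : Finset ι) (F : ι → (Fin r → ZMod 3) → ZMod 2) :
    ∀ ws : List (Fin r → ZMod 3), iterDV ws (∑ i ∈ s, F i) = ∑ i ∈ s, iterDV ws (F i)
  | [] => rfl
  | w :: ws => by
    rw [iterDV, iterDV_sum s F ws, DV_sum]; rfl

/-- The difference of a constant vanishes. [folklore] -/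
private theorem DV_const (w : Fin r → ZMod 3) (c : ZMod 2) : DV w (fun _ => c) = 0 := by
  funext p; simp only [DV, Pi.zero_apply, add_self_zmod2]

/-- The difference of the zero function vanishes. [folklore] -/
private theorem DV_zero_fun (w : Fin r → ZMod 3) : DV w (0 : (Fin r → ZMod 3) → ZMod 2) = 0 := by
  funext p; simp [DV]

/-- A non-empty iterated difference of a constant vanishes. [folklore] -/
private theorem iterDV_const (c : ZMod 2) :
    ∀ ws : List (Fin r → ZMod 3), ws ≠ [] → iterDV ws (fun _ => c) = 0
  | [], hne => absurd rfl hne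
  | [w], _ => by rw [iterDV, iterDV, DV_const]
  | w :: w' :: ws, _ => by rw [iterDV, iterDV_const c (w' :: ws) (by simp), DV_zero_fun]

/-! ### 3. Two facts of linear algebra over `ℤ/3` -/

/-- Non-zero elements of `ℤ/3` square to `1`. [folklore] -/
private theorem mul_self_of_ne_zero (x : ZMod 3) (hx : x ≠ 0) : x * x = 1 := by
  revert x; decide

/-- A non-zero linear form on `(ℤ/3)^r` is onto. [folklore] -/
private theorem exists_dotProduct_eq (d : Fin r → ZMod 3) (hd : d ≠ 0) (t : ZMod 3) :
    ∃ p : Fin r → ZMod 3, d ⬝ᵥ p = t := by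
  obtain ⟨i, hi⟩ : ∃ i, d i ≠ 0 := by
    by_contra hall
    exact hd (funext fun i => by_contra fun h => hall ⟨i, h⟩)
  refine ⟨Pi.single i (d i * t), ?_⟩
  rw [dotProduct_single, ← mul_assoc, mul_self_of_ne_zero _ hi, one_mul]

/-- For non-proportional forms `dⱼ`, `d_k` (`d_k ≠ 0`) there is a vector annihilated by `d_k` but not by `dⱼ`
[cf. Ismailov2020, Ch. 2, proof of Lemma 2.5: «there is a vector `bʲ` with `bʲ·aʲ = 0` and `bʲ·aᵏ ≠ 0`»]. [folklore] -/
private theorem exists_annihilator (dj dk : Fin r → ZMod 3) (hk : dk ≠ 0) (hnp : ∀ a : ZMod 3, dj ≠ a • dk) :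
    ∃ w : Fin r → ZMod 3, dk ⬝ᵥ w = 0 ∧ dj ⬝ᵥ w ≠ 0 := by
  by_contra hall
  have hall' : ∀ w : Fin r → ZMod 3, dk ⬝ᵥ w = 0 → dj ⬝ᵥ w = 0 := fun w hw => by
    by_contra h; exact hall ⟨w, hw, h⟩
  obtain ⟨i₀, hi₀⟩ : ∃ i, dk i ≠ 0 := by
    by_contra h
    exact hk (funext fun i => by_contra fun h' => h ⟨i, h'⟩)
  refine hnp (dj i₀ * dk i₀) (funext fun i => ?_)
  have hw : dk ⬝ᵥ (Pi.single i (1 : ZMod 3) - Pi.single i₀ (dk i * dk i₀)) = 0 := by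
    rw [dotProduct_sub, dotProduct_single, dotProduct_single, mul_one, mul_comm (dk i₀), mul_assoc,
      mul_self_of_ne_zero _ hi₀, mul_one, sub_self]
  have h := hall' _ hw
  rw [dotProduct_sub, dotProduct_single, dotProduct_single, mul_one, sub_eq_zero] at h
  rw [h, Pi.smul_apply, smul_eq_mul]; ring

/-! ### 4. Direction separation -/

/-- **Direction separation over `(ℤ/3)^r` with `𝔽₂` values.**  Let `d₁ … d_m : Fin r → ZMod 3` be non-zero and
pairwise non-proportional and `g₁ … g_m : ZMod 3 → ZMod 2` arbitrary.  If `p ↦ Σⱼ gⱼ (dⱼ ⬝ᵥ p)` is constant on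
`Fin r → ZMod 3`, then every `gⱼ` is constant.  Proof: for `k ≠ j` pick `w_k` with `d_k ⬝ᵥ w_k = 0 ≠ dⱼ ⬝ᵥ w_k`
and apply all `Δ_{w_k}`; every ridge term `k ≠ j` dies, the constant dies, and `gⱼ` is annihilated by an iterated
difference with non-zero steps, hence constant (`const_of_iterD`); `m = 1` is direct.
[cite: Ismailov2020, Ch. 2 Lemma 2.5, eq. (2.23) (difference-operator elimination of ridge directions; the finite
instance `(ℤ/3)^r → 𝔽₂`, where annihilated functions are constant, is supplied here)] -/
theorem dirSep : ∀ (r m : ℕ) (d : Fin m → Fin r → ZMod 3) (g : Fin m → ZMod 3 → ZMod 2) (c : ZMod 2),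
    (∀ j, d j ≠ 0) → (∀ j k, j ≠ k → ∀ a : ZMod 3, d j ≠ a • d k) →
    (∀ p : Fin r → ZMod 3, ∑ j, g j (d j ⬝ᵥ p) = c) → ∀ j t, g j t = g j 0 := by
  intro r m d g c hd hnp hc j
  classical
  by_cases hm : (univ.erase j : Finset (Fin m)) = ∅
  · -- a single direction: `g j (d j ⬝ᵥ p) = c` for all `p`, and `d j ⬝ᵥ ·` is onto
    have hsingle : ∀ p : Fin r → ZMod 3, g j (d j ⬝ᵥ p) = c := by
      intro p
      have h := hc p
      rw [sum_eq_single j] at h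
      · exact h
      · intro k _ hkj
        have : k ∈ (univ.erase j : Finset (Fin m)) := mem_erase.2 ⟨hkj, mem_univ k⟩
        rw [hm] at this; exact absurd this (by simp)
      · intro h'; exact absurd (mem_univ j) h'
    intro t
    obtain ⟨p, hp⟩ := exists_dotProduct_eq (d j) (hd j) t
    obtain ⟨p₀, hp₀⟩ := exists_dotProduct_eq (d j) (hd j) 0
    rw [← hp, hsingle p, ← hp₀, hsingle p₀]
  · -- annihilating directions for every `k ≠ j`
    have hw : ∀ k, k ≠ j → ∃ w : Fin r → ZMod 3, d k ⬝ᵥ w = 0 ∧ d j ⬝ᵥ w ≠ 0 :=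
      fun k hk => exists_annihilator (d j) (d k) (hd k) (hnp j k (Ne.symm hk))
    choose! w hw0 hw1 using hw
    set ks : List (Fin m) := (univ.erase j : Finset (Fin m)).toList with hks
    set ws : List (Fin r → ZMod 3) := ks.map w with hws
    have hks_ne : ks ≠ [] := by
      obtain ⟨k, hk⟩ := nonempty_iff_ne_empty.2 hm
      intro h
      have : k ∈ ks := (mem_toList).2 hk
      rw [h] at this; simp at this
    have hws_ne : ws ≠ [] := by
      intro h; exact hks_ne (List.map_eq_nil_iff.1 h)
    have hconst : (∑ k : Fin m, fun p : Fin r → ZMod 3 => g k (d k ⬝ᵥ p)) = fun _ => c := by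
      funext p; rw [Finset.sum_apply]; exact hc p
    have key := congrArg (iterDV ws) hconst
    rw [iterDV_sum, iterDV_const c ws hws_ne] at key
    simp only [iterDV_ridge] at key
    rw [sum_eq_single j] at key
    · -- `key`: the `j`-th iterated difference vanishes as a function of `p`
      have hz : iterD (ws.map fun w' => d j ⬝ᵥ w') (g j) = 0 := by
        funext t
        obtain ⟨p, hp⟩ := exists_dotProduct_eq (d j) (hd j) t
        have h := congrFun key p
        simp only [Pi.zero_apply] at h
        rw [hp] at h; exact h
      refine const_of_iterD _ (g j) ?_ ?_ hz
      · intro h; exact hws_ne (List.map_eq_nil_iff.1 h)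
      · intro a ha
        obtain ⟨w', hw', rfl⟩ := List.mem_map.1 ha
        obtain ⟨k, hk, rfl⟩ := List.mem_map.1 hw'
        have hkj : k ≠ j := (mem_erase.1 ((mem_toList).1 hk)).1
        exact hw1 k hkj
    · intro k _ hkj
      have hk : k ∈ ks := (mem_toList).2 (mem_erase.2 ⟨hkj, mem_univ k⟩)
      have hmem : (0 : ZMod 3) ∈ ws.map (fun w' => d k ⬝ᵥ w') :=
        List.mem_map.2 ⟨w k, List.mem_map.2 ⟨k, hk, rfl⟩, hw0 k hkj⟩
      funext p
      rw [iterD_eq_zero_of_mem _ _ hmem]; rfl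
    · intro h; exact absurd (mem_univ j) h

end ModThreeDirSep

end Literature.Computability.MetaComplexity
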